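import Mathlib
import Summits.PneNP.PneNP.Theorems.RamseyUncertifiableRegularResolutionRungTrapSparseFalseCharSum

/-!
# The four blocks of the points/hyperplanes graph are quasi-random (helper 4a/5)

For point sets `AΩ, YΩ ⊆ F₂^d` and hyperplane sets `AP, YP`, the number of adjacent ordered pairs in each of
the four blocks of `hadamardGraph d` is `|·||·|/2` up to a character sum bounded by Lindsey's lemma (plus a
diagonal correction of at most the size of the left set in the two square blocks). [folklore]
-/

noncomputable section

open Finset Matrix

namespace Summit.PneNP.PneNP.Cruxes.RegularResolutionRung.SoundPathBottleneck.HadamardWitness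

set_option linter.dupNamespace false -- `Summit.PneNP.PneNP.…`: single-conjunct summit (D-0017)

variable {d : ℕ}

/-- Finset form of the weighted Lindsey bound: for `φ, ψ` bounded by `1`,
`|Σ_{x∈S} Σ_{y∈T} φ x ψ y chi⟪x,y⟫| ≤ √(|S| · 2^d · |T|)`. -/
theorem abs_charSum_finset_le (S T : Finset (Vec d)) (φ ψ : Vec d → ℝ) (hφ : ∀ x, |φ x| ≤ 1)
    (hψ : ∀ y, |ψ y| ≤ 1) :
    |∑ x ∈ S, ∑ y ∈ T, φ x * ψ y * chi (x ⬝ᵥ y)| ≤ Real.sqrt (S.card * ((2 : ℝ) ^ d * T.card)) := by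
  classical
  set f : Vec d → ℝ := fun x => if x ∈ S then φ x else 0 with hf
  set g : Vec d → ℝ := fun y => if y ∈ T then ψ y else 0 with hg
  have hrew : ∑ x ∈ S, ∑ y ∈ T, φ x * ψ y * chi (x ⬝ᵥ y) = ∑ x, ∑ y, f x * g y * chi (x ⬝ᵥ y) := by
    rw [← Finset.sum_subset (Finset.subset_univ S) (f := fun x => ∑ y, f x * g y * chi (x ⬝ᵥ y))
      (fun x _ hx => by simp [hf, hx])]
    refine Finset.sum_congr rfl fun x hx => ?_
    rw [← Finset.sum_subset (Finset.subset_univ T) (f := fun y => f x * g y * chi (x ⬝ᵥ y))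
      (fun y _ hy => by simp [hg, hy])]
    refine Finset.sum_congr rfl fun y hy => ?_
    simp [hf, hg, hx, hy]
  rw [hrew]
  refine (abs_charSum_le f g).trans (Real.sqrt_le_sqrt ?_)
  have hf2 : ∑ x, f x ^ 2 ≤ S.card := by
    have e : ∑ x ∈ S, f x ^ 2 = ∑ x, f x ^ 2 :=
      Finset.sum_subset (Finset.subset_univ S) (fun x _ hx => by simp [hf, hx])
    rw [← e]
    calc ∑ x ∈ S, f x ^ 2 ≤ ∑ _x ∈ S, (1 : ℝ) := Finset.sum_le_sum fun x hx => by
            have : |f x| ≤ 1 := by simp only [hf, hx, if_true]; exact hφ x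
            exact (sq_le_one_iff_abs_le_one _).2 this
      _ = S.card := by simp
  have hg2 : ∑ y, g y ^ 2 ≤ T.card := by
    have e : ∑ y ∈ T, g y ^ 2 = ∑ y, g y ^ 2 :=
      Finset.sum_subset (Finset.subset_univ T) (fun y _ hy => by simp [hg, hy])
    rw [← e]
    calc ∑ y ∈ T, g y ^ 2 ≤ ∑ _y ∈ T, (1 : ℝ) := Finset.sum_le_sum fun y hy => by
            have : |g y| ≤ 1 := by simp only [hg, hy, if_true]; exact hψ y
            exact (sq_le_one_iff_abs_le_one _).2 this
      _ = T.card := by simp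
  have hgnn : (0 : ℝ) ≤ ∑ y, g y ^ 2 := Finset.sum_nonneg fun y _ => sq_nonneg _
  exact mul_le_mul hf2 (mul_le_mul_of_nonneg_left hg2 (by positivity)) (by positivity) (Nat.cast_nonneg _)

/-- Equality in `F₂` as vanishing of the sum. -/
theorem zmod2_eq_iff_add_eq_zero (u v : ZMod 2) : u = v ↔ u + v = 0 := by revert u v; decide

/-! ## Block Ω × P (incidence) -/

/-- The incidence indicator through the character. -/
theorem ind_incidence (x : Vec d) (p : Hyp d) :
    (if p.a ⬝ᵥ x = p.b then (1 : ℝ) else 0) = (1 + chi p.b * chi (p.a ⬝ᵥ x)) / 2 := by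
  have key : (if p.a ⬝ᵥ x + p.b = 0 then (1 : ℝ) else 0) = (1 + chi p.b * chi (p.a ⬝ᵥ x)) / 2 := by
    rw [indicator_eq_zero, chi_add, mul_comm]
  rw [← key]
  by_cases h : p.a ⬝ᵥ x = p.b
  · rw [if_pos h, if_pos ((zmod2_eq_iff_add_eq_zero _ _).1 h)]
  · rw [if_neg h, if_neg (fun h' => h ((zmod2_eq_iff_add_eq_zero _ _).2 h'))]

/-- **Block Ω×P.** `Σ_{x∈AΩ} Σ_{p∈YP} [x ∈ p] = |AΩ||YP|/2 + C/2` with `|C| ≤ √(|AΩ| 2^d 2|YP|)`. -/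
theorem block_pts_hyps (AΩ : Finset (Vec d)) (YP : Finset (Hyp d)) :
    |(∑ x ∈ AΩ, ∑ p ∈ YP, if p.a ⬝ᵥ x = p.b then (1 : ℝ) else 0) - AΩ.card * YP.card / 2| ≤
      Real.sqrt (AΩ.card * ((2 : ℝ) ^ d * (2 * YP.card))) / 2 := by
  classical
  set f : Vec d → ℝ := fun x => if x ∈ AΩ then 1 else 0 with hf
  set C : ℝ := ∑ x ∈ AΩ, ∑ p ∈ YP, f x * chi p.b * chi (p.a ⬝ᵥ x) with hCdef
  have hrew : (∑ x ∈ AΩ, ∑ p ∈ YP, if p.a ⬝ᵥ x = p.b then (1 : ℝ) else 0) = AΩ.card * YP.card / 2 + C / 2 := by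
    have h1 : ∀ x ∈ AΩ, (∑ p ∈ YP, if p.a ⬝ᵥ x = p.b then (1 : ℝ) else 0) =
        (YP.card : ℝ) / 2 + (∑ p ∈ YP, f x * chi p.b * chi (p.a ⬝ᵥ x)) / 2 := by
      intro x hx
      have hfx : f x = 1 := by simp [hf, hx]
      have hpt : ∀ p ∈ YP, (if p.a ⬝ᵥ x = p.b then (1 : ℝ) else 0) =
          1 / 2 + (f x * chi p.b * chi (p.a ⬝ᵥ x)) / 2 := by
        intro p _
        rw [ind_incidence, hfx]
        ring
      rw [Finset.sum_congr rfl hpt, Finset.sum_add_distrib, Finset.sum_const, nsmul_eq_mul, ← Finset.sum_div]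
      ring
    rw [Finset.sum_congr rfl h1, Finset.sum_add_distrib, Finset.sum_const, nsmul_eq_mul, hCdef, ← Finset.sum_div]
    ring
  rw [hrew]
  have hC : |C| ≤ Real.sqrt (AΩ.card * ((2 : ℝ) ^ d * (2 * YP.card))) :=
    abs_blockSum_le AΩ YP f (fun p => chi p.b) (fun x => by simp only [hf]; split_ifs <;> simp)
      (fun x hx => by simp [hf, hx]) (fun p => abs_chi_le p.b)
  rw [show (AΩ.card : ℝ) * YP.card / 2 + C / 2 - AΩ.card * YP.card / 2 = C / 2 by ring, abs_div, abs_two]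
  exact div_le_div_of_nonneg_right hC (by norm_num)

/-- **Block P×Ω** (the transpose of the incidence block). -/
theorem block_hyps_pts (AP : Finset (Hyp d)) (YΩ : Finset (Vec d)) :
    |(∑ p ∈ AP, ∑ y ∈ YΩ, if p.a ⬝ᵥ y = p.b then (1 : ℝ) else 0) - AP.card * YΩ.card / 2| ≤
      Real.sqrt (YΩ.card * ((2 : ℝ) ^ d * (2 * AP.card))) / 2 := by
  rw [Finset.sum_comm, show (AP.card : ℝ) * YΩ.card = YΩ.card * AP.card by ring]
  exact block_pts_hyps YΩ AP

/-! ## Block Ω × Ω -/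

/-- Diagonal bookkeeping: the pairs `(x, x)` contribute at most `|AΩ|`. -/
theorem sum_diag_le (AΩ YΩ : Finset (Vec d)) (P : Vec d → Vec d → Prop) [DecidableRel P] :
    (0 : ℝ) ≤ ∑ x ∈ AΩ, ∑ y ∈ YΩ, (if x = y ∧ P x y then (1 : ℝ) else 0) ∧
    (∑ x ∈ AΩ, ∑ y ∈ YΩ, (if x = y ∧ P x y then (1 : ℝ) else 0)) ≤ AΩ.card := by
  classical
  constructor
  · exact Finset.sum_nonneg fun x _ => Finset.sum_nonneg fun y _ => by split_ifs <;> norm_num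
  · calc (∑ x ∈ AΩ, ∑ y ∈ YΩ, (if x = y ∧ P x y then (1 : ℝ) else 0))
        ≤ ∑ x ∈ AΩ, ∑ y ∈ YΩ, (if x = y then (1 : ℝ) else 0) := by
          refine Finset.sum_le_sum fun x _ => Finset.sum_le_sum fun y _ => ?_
          by_cases hxy : x = y
          · subst hxy
            simp only [true_and, if_true]
            split_ifs <;> norm_num
          · simp [hxy]
      _ ≤ ∑ _x ∈ AΩ, (1 : ℝ) := by
          refine Finset.sum_le_sum fun x _ => ?_
          rw [Finset.sum_ite_eq]
          split_ifs <;> norm_num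
      _ = AΩ.card := by simp

/-- **Block Ω×Ω.** `Σ_{x∈AΩ} Σ_{y∈YΩ} [x ≠ y ∧ ⟪x,y⟫ = 1] = |AΩ||YΩ|/2 − C/2 − D` with
`|C| ≤ √(|AΩ| 2^d |YΩ|)` and `0 ≤ D ≤ |AΩ|`. -/
theorem block_pts_pts (AΩ YΩ : Finset (Vec d)) :
    |(∑ x ∈ AΩ, ∑ y ∈ YΩ, if (x ≠ y ∧ x ⬝ᵥ y = 1) then (1 : ℝ) else 0) - AΩ.card * YΩ.card / 2| ≤
      Real.sqrt (AΩ.card * ((2 : ℝ) ^ d * YΩ.card)) / 2 + AΩ.card := by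
  classical
  set C : ℝ := ∑ x ∈ AΩ, ∑ y ∈ YΩ, (1 : ℝ) * 1 * chi (x ⬝ᵥ y) with hC
  set D : ℝ := ∑ x ∈ AΩ, ∑ y ∈ YΩ, (if x = y ∧ x ⬝ᵥ y = 1 then (1 : ℝ) else 0) with hD
  have hpt : ∀ x y : Vec d, (if (x ≠ y ∧ x ⬝ᵥ y = 1) then (1 : ℝ) else 0) =
      (1 / 2 - (1 : ℝ) * 1 * chi (x ⬝ᵥ y) / 2) - (if x = y ∧ x ⬝ᵥ y = 1 then (1 : ℝ) else 0) := by
    intro x y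
    have h1 : (if x ⬝ᵥ y = 1 then (1 : ℝ) else 0) = 1 / 2 - (1 : ℝ) * 1 * chi (x ⬝ᵥ y) / 2 := by
      rw [indicator_eq_one]; ring
    rw [← h1]
    by_cases hxy : x = y <;> by_cases hd : x ⬝ᵥ y = 1 <;> simp [hxy, hd]
  have hrew : (∑ x ∈ AΩ, ∑ y ∈ YΩ, if (x ≠ y ∧ x ⬝ᵥ y = 1) then (1 : ℝ) else 0) =
      AΩ.card * YΩ.card / 2 - C / 2 - D := by
    simp_rw [hpt]
    rw [hC, hD]
    simp_rw [Finset.sum_sub_distrib, Finset.sum_const, nsmul_eq_mul, Finset.sum_div]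
    ring
  rw [hrew]
  have hCb : |C| ≤ Real.sqrt (AΩ.card * ((2 : ℝ) ^ d * YΩ.card)) :=
    abs_charSum_finset_le AΩ YΩ (fun _ => 1) (fun _ => 1) (fun _ => by simp) (fun _ => by simp)
  obtain ⟨hD0, hD1⟩ := sum_diag_le AΩ YΩ (fun x y => x ⬝ᵥ y = 1)
  rw [← hD] at hD0 hD1
  have : |(AΩ.card : ℝ) * YΩ.card / 2 - C / 2 - D - AΩ.card * YΩ.card / 2| = |-(C / 2 + D)| := by
    congr 1; ring
  rw [this, abs_neg]
  calc |C / 2 + D| ≤ |C / 2| + |D| := abs_add_le _ _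
    _ = |C| / 2 + D := by rw [abs_div, abs_two, abs_of_nonneg hD0]
    _ ≤ Real.sqrt (AΩ.card * ((2 : ℝ) ^ d * YΩ.card)) / 2 + AΩ.card := by gcongr

/-! ## Block P × P -/

/-- The character sum of the P×P block for a fixed constant term `β` of the second hyperplane. -/
theorem abs_hypSum_fixed_le (AP YP : Finset (Hyp d)) (β : ZMod 2) :
    |∑ p' ∈ YP.filter (fun p' => p'.b = β), ∑ p ∈ AP, chi (p.b * β) * chi (p.a ⬝ᵥ p'.a)| ≤
      Real.sqrt (YP.card * ((2 : ℝ) ^ d * (2 * AP.card))) := by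
  classical
  set Yβ := YP.filter (fun p' => p'.b = β) with hYβ
  set T : Finset (Vec d) := Yβ.image (fun p' => p'.a) with hT
  have hinj : Set.InjOn (fun p' : Hyp d => p'.a) Yβ := by
    intro p₁ h₁ p₂ h₂ ha
    rw [Finset.mem_coe, hYβ, Finset.mem_filter] at h₁ h₂
    apply Subtype.ext
    exact Prod.ext ha (h₁.2.trans h₂.2.symm)
  set f : Vec d → ℝ := fun x => if x ∈ T then 1 else 0 with hf
  have hrew : ∑ p' ∈ Yβ, ∑ p ∈ AP, chi (p.b * β) * chi (p.a ⬝ᵥ p'.a) =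
      ∑ x ∈ T, ∑ p ∈ AP, f x * chi (p.b * β) * chi (p.a ⬝ᵥ x) := by
    rw [hT, Finset.sum_image hinj]
    refine Finset.sum_congr rfl fun p' hp' => Finset.sum_congr rfl fun p _ => ?_
    have : f p'.a = 1 := by
      simp only [hf]
      rw [if_pos (Finset.mem_image_of_mem _ hp')]
    rw [this, one_mul]
  rw [hrew]
  have hTcard : (T.card : ℝ) ≤ YP.card := by
    have h1 : T.card ≤ Yβ.card := Finset.card_image_le
    have h2 : Yβ.card ≤ YP.card := Finset.card_filter_le _ _
    exact_mod_cast h1.trans h2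
  calc |∑ x ∈ T, ∑ p ∈ AP, f x * chi (p.b * β) * chi (p.a ⬝ᵥ x)|
      ≤ Real.sqrt (T.card * ((2 : ℝ) ^ d * (2 * AP.card))) :=
        abs_blockSum_le T AP f (fun p => chi (p.b * β)) (fun x => by simp only [hf]; split_ifs <;> simp)
          (fun x hx => by simp [hf, hx]) (fun p => abs_chi_le _)
    _ ≤ Real.sqrt (YP.card * ((2 : ℝ) ^ d * (2 * AP.card))) := by gcongr

/-- **Block P×P.** `Σ_{p∈AP} Σ_{p'∈YP} [p ≠ p' ∧ ⟪a,a'⟫ + bb' = 1] = |AP||YP|/2 − C/2 − D` with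
`|C| ≤ 2√(|YP| 2^d 2|AP|)` and `0 ≤ D ≤ |AP|`. -/
theorem block_hyps_hyps (AP YP : Finset (Hyp d)) :
    |(∑ p ∈ AP, ∑ p' ∈ YP, if (p ≠ p' ∧ p.a ⬝ᵥ p'.a + p.b * p'.b = 1) then (1 : ℝ) else 0)
        - AP.card * YP.card / 2| ≤
      Real.sqrt (YP.card * ((2 : ℝ) ^ d * (2 * AP.card))) + AP.card := by
  classical
  set C : ℝ := ∑ p ∈ AP, ∑ p' ∈ YP, chi (p.b * p'.b) * chi (p.a ⬝ᵥ p'.a) with hC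
  set D : ℝ := ∑ p ∈ AP, ∑ p' ∈ YP, (if p = p' ∧ p.a ⬝ᵥ p'.a + p.b * p'.b = 1 then (1 : ℝ) else 0) with hD
  have hpt : ∀ p p' : Hyp d, (if (p ≠ p' ∧ p.a ⬝ᵥ p'.a + p.b * p'.b = 1) then (1 : ℝ) else 0) =
      (1 / 2 - chi (p.b * p'.b) * chi (p.a ⬝ᵥ p'.a) / 2)
        - (if p = p' ∧ p.a ⬝ᵥ p'.a + p.b * p'.b = 1 then (1 : ℝ) else 0) := by
    intro p p'
    have h1 : (if p.a ⬝ᵥ p'.a + p.b * p'.b = 1 then (1 : ℝ) else 0) =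
        1 / 2 - chi (p.b * p'.b) * chi (p.a ⬝ᵥ p'.a) / 2 := by
      rw [indicator_eq_one, chi_add]; ring
    rw [← h1]
    by_cases hxy : p = p' <;> by_cases hd : p.a ⬝ᵥ p'.a + p.b * p'.b = 1 <;> simp [hxy, hd]
  have hrew : (∑ p ∈ AP, ∑ p' ∈ YP, if (p ≠ p' ∧ p.a ⬝ᵥ p'.a + p.b * p'.b = 1) then (1 : ℝ) else 0) =
      AP.card * YP.card / 2 - C / 2 - D := by
    simp_rw [hpt]
    rw [hC, hD]
    simp_rw [Finset.sum_sub_distrib, Finset.sum_const, nsmul_eq_mul, Finset.sum_div]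
    ring
  rw [hrew]
  -- bound C by splitting the second hyperplane by its constant term
  have hCb : |C| ≤ 2 * Real.sqrt (YP.card * ((2 : ℝ) ^ d * (2 * AP.card))) := by
    have hsplit : C = (∑ p' ∈ YP.filter (fun p' => p'.b = 0), ∑ p ∈ AP, chi (p.b * 0) * chi (p.a ⬝ᵥ p'.a))
        + (∑ p' ∈ YP.filter (fun p' => p'.b = 1), ∑ p ∈ AP, chi (p.b * 1) * chi (p.a ⬝ᵥ p'.a)) := by
      rw [hC, Finset.sum_comm]
      rw [← Finset.sum_filter_add_sum_filter_not YP (fun p' => p'.b = 0)]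
      congr 1
      · refine Finset.sum_congr rfl fun p' hp' => Finset.sum_congr rfl fun p _ => ?_
        rw [(Finset.mem_filter.1 hp').2]
      · have : YP.filter (fun p' => ¬ p'.b = 0) = YP.filter (fun p' => p'.b = 1) := by
          refine Finset.filter_congr fun p' _ => ?_
          rcases zmod2_cases p'.b with h | h <;> simp [h]
        rw [this]
        refine Finset.sum_congr rfl fun p' hp' => Finset.sum_congr rfl fun p _ => ?_
        rw [(Finset.mem_filter.1 hp').2]
    rw [hsplit]
    calc _ ≤ |∑ p' ∈ YP.filter (fun p' => p'.b = 0), ∑ p ∈ AP, chi (p.b * 0) * chi (p.a ⬝ᵥ p'.a)|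
          + |∑ p' ∈ YP.filter (fun p' => p'.b = 1), ∑ p ∈ AP, chi (p.b * 1) * chi (p.a ⬝ᵥ p'.a)| :=
          abs_add_le _ _
      _ ≤ Real.sqrt (YP.card * ((2 : ℝ) ^ d * (2 * AP.card))) + Real.sqrt (YP.card * ((2 : ℝ) ^ d * (2 * AP.card))) :=
          add_le_add (abs_hypSum_fixed_le AP YP 0) (abs_hypSum_fixed_le AP YP 1)
      _ = _ := by ring
  -- bound D
  have hD0 : 0 ≤ D := Finset.sum_nonneg fun p _ => Finset.sum_nonneg fun p' _ => by
    rw [hD.symm.symm] at *; split_ifs <;> norm_num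
  have hD1 : D ≤ AP.card := by
    calc D ≤ ∑ p ∈ AP, ∑ p' ∈ YP, (if p = p' then (1 : ℝ) else 0) := by
          refine Finset.sum_le_sum fun p _ => Finset.sum_le_sum fun p' _ => ?_
          by_cases hxy : p = p'
          · subst hxy
            simp only [true_and, if_true]
            split_ifs <;> norm_num
          · simp [hxy]
      _ ≤ ∑ _p ∈ AP, (1 : ℝ) := by
          refine Finset.sum_le_sum fun p _ => ?_
          rw [Finset.sum_ite_eq]
          split_ifs <;> norm_num
      _ = AP.card := by simp
  have : |(AP.card : ℝ) * YP.card / 2 - C / 2 - D - AP.card * YP.card / 2| = |-(C / 2 + D)| := by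
    congr 1; ring
  rw [this, abs_neg]
  calc |C / 2 + D| ≤ |C / 2| + |D| := abs_add_le _ _
    _ = |C| / 2 + D := by rw [abs_div, abs_two, abs_of_nonneg hD0]
    _ ≤ 2 * Real.sqrt (YP.card * ((2 : ℝ) ^ d * (2 * AP.card))) / 2 + AP.card := by gcongr
    _ = _ := by ring

/-- Anchor (registered sub-goal `hw_blocks_anchor` of stmt-PneNP-9818): discrepancy of the hyperplane block. -/
theorem hw_blocks_anchor : ∀ (d : ℕ) (AP YP : Finset (Hyp d)),
    |(∑ p ∈ AP, ∑ p' ∈ YP, if (p ≠ p' ∧ p.a ⬝ᵥ p'.a + p.b * p'.b = 1) then (1 : ℝ) else 0)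
        - AP.card * YP.card / 2| ≤
      Real.sqrt (YP.card * ((2 : ℝ) ^ d * (2 * AP.card))) + AP.card :=
  fun _ AP YP => block_hyps_hyps AP YP

end Summit.PneNP.PneNP.Cruxes.RegularResolutionRung.SoundPathBottleneck.HadamardWitness

end
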